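import Literature.Algebra.Homology.DiscreteRepRestrictionExact
import Mathlib.GroupTheory.DoubleCoset
import HarnessLib

/-!
# Pull-back of a module co-induced from an OPEN NORMAL subgroup along a continuous homomorphism:
# `Res_φ Coind_U^Γ(W) ≅ Coind_{φ⁻¹U}^H(W^{U\Γ/φ(H)})` (Mackey's formula, normal case)

Topic `Algebra/Homology`; namespace `Literature.Algebra.Homology.DiscreteRep`.  Definitions with
bodies and theorems; no named fact, no instance, no notation, no `sorry`.  Sequel of door-c4's
`DiscreteRepOpenSubgroup` (`coindD k U hU : C_U ⥤ C_Γ` for `U` open of finite index, Shapiro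
`extCoindResAddEquiv`) and `DiscreteRepRestrictionExact` (`resDHom k φ hφ : C_Γ ⥤ C_H`, the exact
pull-back along a continuous homomorphism `φ : H →* Γ`).

THE STATEMENT (Mackey's double-coset formula, e.g. K. S. Brown, *Cohomology of Groups* III (5.6)
(b); J.-P. Serre, *Représentations linéaires des groupes finis* §7.3 Prop. 22; here in the special
case of a NORMAL subgroup, where all the conjugate subgroups coincide).  Let `φ : H →* Γ` be a
continuous homomorphism of topological groups, `U ≤ Γ` an open normal subgroup of finite index,
`V = φ⁻¹(U)` (open, normal, of finite index in `H`) and `T = U\Γ/φ(H)` the (finite) double-coset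
space.  For a `k`-module `W` with trivial action, the pull-back along `φ` of the co-induced module
`Coind_U^Γ(W) = {f : Γ → W | f(ux) = f(x)}` (functions on `U\Γ`, `Γ` acting by right translation)
is isomorphic in `C_H` to `Coind_V^H(W^T) = {F : H → (T → W) | F(vh) = F(h)}`:

  `Ψ f h t = f (s(t) · φ h)`      (`s : T → Γ` a section of `Γ → U\Γ/φ(H)`),

because `U\Γ ≅ T × V\H` as right `H`-sets (`Ux ↦ (t(x), Vh)` for `x ∈ U s(t) φ(h)`; the
stabiliser of every `U s(t)` in `H` is `φ⁻¹(s(t)⁻¹ U s(t)) = φ⁻¹(U) = V` by normality).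

USE (lane «PT-Ш-S-TC» of crux `stmt-BirchSwinnertonDyer-19032`, cell bsd-eis, brick (Λ)(e), file
E2 of `LAMBDA-E-DEVISSAGE-w4g20.md`): with `Γ = G_S`, `H = Γ_{K_v}`, `φ` the decomposition map and
`U` acting trivially on the finite module `A`, the permutation modules `Coind_U^{G_S}(ℤ^m)` of a
presentation of `A` pull back to permutation modules of `Γ_{K_v}` for the single open subgroup
`V = Gal(K̄_v/E_w)` (`E = K_S^U`), one copy per place of `E` above `v` (`T ↔ {w ∣ v}`); with
Shapiro's lemma over `(Γ_{K_v}, V)` this computes the local side of the localisation maps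
`ExtLocalization.locMap` on permutation modules.  HONEST FRAMING: module bookkeeping; no
arithmetic statement and nothing about BSD is proved here.  AI formalisation, established only by
the kernel check.

## What is here
* §1 `DoubleCosets φ U = U\Γ/φ(H)` (Mathlib `DoubleCoset.Quotient`), the section `dcRep`,
  `exists_decomp` (`x = u · s(t(x)) · φ h`), `mul_inv_mem_comap_of_eq` (two decompositions over the
  same `t` differ by `V` on the `H`-side), `finite_doubleCosets`, `finiteIndex_comap`,
  `isOpen_comap`.
* §2 `coindPullbackFun` / `coindPullbackHom : Res_φ Coind_U(W) ⟶ Coind_V(W^T)` in `C_H`, its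
  formula, `coindPullbackHom_injective`, `coindPullbackHom_surjective`, and the isomorphism
  **`coindPullbackIso φ hφ U hU W : (resDHom k φ hφ).obj ((coindD k U hU).obj (triv W)) ≅
  (coindD k (U.comap φ) _).obj (triv (DoubleCosets φ U → W))`** with `coindPullbackIso_hom_apply`.

## References
* K. S. Brown, *Cohomology of Groups*, GTM 87 (1982), III §5, (5.6) and Prop. 5.6 (b) (Mackey
  formula for `Res Ind`). [Brown1982CohomologyGroups]
* D. Harari, *Galois Cohomology and Class Field Theory*, Universitext (2020), §1.2 (induced
  modules), §4.3 (1), §17.5 Lemma 17.23 (the decomposition `∏_{w∣v} F_wˣ = Ind` used there).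
  [Harari2020]
-/

noncomputable section

universe u

namespace Literature.Algebra.Homology

namespace DiscreteRep

open CategoryTheory CategoryTheory.Limits

/-! ## §1 Double cosets `U\Γ/φ(H)` for `U` normal -/

section DoubleCosets

variable {Γ H : Type u} [Group Γ] [Group H] (φ : H →* Γ) (U : Subgroup Γ)

/-- The double-coset space `T = U\Γ/φ(H)` (Mathlib's `DoubleCoset.Quotient`).
[cite: Brown1982CohomologyGroups, III §5 (5.6)] -/
abbrev DoubleCosets : Type u := DoubleCoset.Quotient (U : Set Γ) (φ.range : Set Γ)

/-- The class of `x ∈ Γ` in `U\Γ/φ(H)`. [cite: Brown1982CohomologyGroups, III §5 (5.6)] -/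
abbrev dcMk (x : Γ) : DoubleCosets φ U := DoubleCoset.mk U φ.range x

/-- A section `s : U\Γ/φ(H) → Γ` (representatives, by choice). [cite: Brown1982CohomologyGroups, III §5 (5.6)] -/
def dcRep (t : DoubleCosets φ U) : Γ := Quotient.out (s := DoubleCoset.setoid (U : Set Γ) (φ.range : Set Γ)) t

/-- `s(t)` represents `t`. [cite: Brown1982CohomologyGroups, III §5 (5.6)] -/
theorem dcMk_dcRep (t : DoubleCosets φ U) : dcMk φ U (dcRep φ U t) = t :=
  DoubleCoset.out_eq' U φ.range t

/-- Left multiplication by `U` does not change the double coset. [cite: Brown1982CohomologyGroups, III §5 (5.6)] -/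
theorem dcMk_mul_left (u : U) (x : Γ) : dcMk φ U ((u : Γ) * x) = dcMk φ U x := by
  rw [eq_comm, DoubleCoset.eq]
  exact ⟨u, u.2, 1, φ.range.one_mem, by rw [mul_one]⟩

/-- Right multiplication by `φ(h)` does not change the double coset.
[cite: Brown1982CohomologyGroups, III §5 (5.6)] -/
theorem dcMk_mul_right (x : Γ) (h : H) : dcMk φ U (x * φ h) = dcMk φ U x := by
  rw [eq_comm, DoubleCoset.eq]
  exact ⟨1, U.one_mem, φ h, ⟨h, rfl⟩, by rw [one_mul]⟩

/-- **Every `x ∈ Γ` decomposes as `x = u · s(t(x)) · φ h`** with `u ∈ U`, `h ∈ H`.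
[cite: Brown1982CohomologyGroups, III §5 (5.6)] -/
theorem exists_decomp (x : Γ) : ∃ (u : U) (h : H), x = (u : Γ) * dcRep φ U (dcMk φ U x) * φ h := by
  obtain ⟨a, b, ha, hb, hab⟩ := DoubleCoset.mk_out_eq_mul U φ.range x
  rw [MonoidHom.mem_range] at hb
  obtain ⟨h, rfl⟩ := hb
  refine ⟨⟨a⁻¹, U.inv_mem ha⟩, h⁻¹, ?_⟩
  have hab' : dcRep φ U (dcMk φ U x) = a * x * φ h := hab
  rw [hab', map_inv]
  change x = a⁻¹ * (a * x * φ h) * (φ h)⁻¹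
  group

variable [hUn : U.Normal]

/-- **Two decompositions over the same representative differ by `V = φ⁻¹(U)` on the `H`-side**: if
`u₁ · s · φ h₁ = u₂ · s · φ h₂` then `h₁ h₂⁻¹ ∈ φ⁻¹(U)` (normality of `U`).
[cite: Brown1982CohomologyGroups, III §5 Prop. 5.6 (b)] -/
theorem mul_inv_mem_comap_of_eq {s : Γ} {u₁ u₂ : U} {h₁ h₂ : H}
    (e : (u₁ : Γ) * s * φ h₁ = (u₂ : Γ) * s * φ h₂) : h₁ * h₂⁻¹ ∈ U.comap φ := by
  rw [Subgroup.mem_comap, map_mul, map_inv]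
  have h12 : φ h₁ * (φ h₂)⁻¹ = s⁻¹ * ((u₁ : Γ)⁻¹ * u₂) * s := by
    have e' : φ h₁ = ((u₁ : Γ) * s)⁻¹ * ((u₂ : Γ) * s * φ h₂) := by
      rw [← e]; group
    rw [e']; group
  rw [h12]
  have hu : ((u₁ : Γ)⁻¹ * u₂ : Γ) ∈ U := U.mul_mem (U.inv_mem u₁.2) u₂.2
  simpa using hUn.conj_mem _ hu s⁻¹

omit hUn in
/-- `U\Γ/φ(H)` is a quotient of `Γ/U`… precisely: the class map factors through left cosets of `U`,
so `T` is finite when `U` has finite index. [cite: Brown1982CohomologyGroups, III §5 (5.6)] -/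
theorem finite_doubleCosets [U.FiniteIndex] : Finite (DoubleCosets φ U) := by
  haveI : Finite (Γ ⧸ U) := Subgroup.finite_quotient_of_finiteIndex
  -- the class map is constant on right `U`-orbits `x ↦ x * u`, i.e. factors through `Γ ⧸ U`… we use
  -- instead the surjection from `Γ ⧸ U` given by `xU ↦ [x]`, well defined since `[x u] = [x]`:
  -- `x u = (x u x⁻¹) x` — but that needs normality; without it use `Quotient (rightRel U)`.
  haveI : Finite (Quotient (QuotientGroup.rightRel U)) :=
    Finite.of_equiv _ (QuotientGroup.quotientRightRelEquivQuotientLeftRel U).symm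
  refine Finite.of_surjective
    (Quotient.lift (s := QuotientGroup.rightRel U) (fun x : Γ => dcMk φ U x) fun x y hxy => ?_) ?_
  · have hxy' : y * x⁻¹ ∈ U := QuotientGroup.rightRel_apply.mp hxy
    -- `y * x⁻¹ ∈ U`, so `y = (y x⁻¹) x`
    have : y = ((⟨y * x⁻¹, hxy'⟩ : U) : Γ) * x := by simp
    change dcMk φ U x = dcMk φ U y
    rw [this, dcMk_mul_left]
  · intro t
    induction t using Quotient.inductionOn with
    | h x => exact ⟨Quotient.mk _ x, rfl⟩

omit hUn in
/-- `φ⁻¹(U)` is open for `U` open and `φ` continuous. [cite: Harari2020, §4.2] -/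
theorem isOpen_comap [TopologicalSpace Γ] [TopologicalSpace H] (hφ : Continuous φ)
    (hU : IsOpen (U : Set Γ)) : IsOpen ((U.comap φ : Subgroup H) : Set H) :=
  hU.preimage hφ

/-- `φ⁻¹(U)` has finite index when `U` is normal of finite index (`[H : φ⁻¹U] = [φ(H)U : U]`
divides `[Γ : U]`). [cite: Brown1982CohomologyGroups, III §5 (5.6)] -/
theorem finiteIndex_comap [U.FiniteIndex] : (U.comap φ).FiniteIndex := by
  refine ⟨fun h0 => ?_⟩
  rw [Subgroup.index_comap] at h0
  have hdvd := Subgroup.relIndex_dvd_index_of_normal U φ.range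
  rw [h0, zero_dvd_iff] at hdvd
  exact Subgroup.FiniteIndex.index_ne_zero hdvd

end DoubleCosets

/-! ## §2 The isomorphism `Res_φ Coind_U^Γ(W) ≅ Coind_{φ⁻¹U}^H(W^T)` -/

section Pullback

variable {k Γ H : Type u} [CommRing k] [Group Γ] [TopologicalSpace Γ] [IsTopologicalGroup Γ]
  [Group H] [TopologicalSpace H] [IsTopologicalGroup H]
  (φ : H →* Γ) (hφ : Continuous φ) (U : Subgroup Γ) [hUn : U.Normal] (hU : IsOpen (U : Set Γ))
  [U.FiniteIndex] [hVf : (U.comap φ).FiniteIndex]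
  (W : Type u) [AddCommGroup W] [Module k W]

/-- The source `Res_φ Coind_U^Γ (triv W)` as an object of `C_H`. [cite: Brown1982CohomologyGroups, III §5 (5.6)] -/
abbrev coindPullbackSrc : DiscreteRepCat k H :=
  (resDHom k φ hφ).obj ((coindD k U hU).obj (triv (k := k) (Γ := U) W))

/-- The target `Coind_{φ⁻¹U}^H (triv (T → W))` as an object of `C_H`. [cite: Brown1982CohomologyGroups, III §5 (5.6)] -/
abbrev coindPullbackTgt : DiscreteRepCat k H :=
  (coindD k (U.comap φ) (isOpen_comap φ U hφ hU)).obj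
    (triv (k := k) (Γ := (U.comap φ)) (DoubleCosets φ U → W))

omit [IsTopologicalGroup H] hUn hVf in
/-- Elements of the source are functions `f : Γ → W` with `f (u x) = f x`.
[cite: Brown1982CohomologyGroups, III §5 (5.6)] -/
theorem coindPullbackSrc_apply_mul_left (f : (coindPullbackSrc φ hφ U hU W (k := k)).obj.V)
    (u : U) (x : Γ) : f.1 ((u : Γ) * x) = f.1 x :=
  ((Representation.mem_coindV _ _ _).1 f.2) u x

/-- **The Mackey map on vectors**: `Ψ f h t = f (s(t) · φ h)`.
[cite: Brown1982CohomologyGroups, III §5 Prop. 5.6 (b)] -/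
def coindPullbackFun (f : (coindPullbackSrc φ hφ U hU W (k := k)).obj.V) :
    (coindPullbackTgt φ hφ U hU W (k := k)).obj.V :=
  ⟨fun h t => f.1 (dcRep φ U t * φ h), fun v h => by
    funext t
    change f.1 (dcRep φ U t * φ ((v : H) * h)) = f.1 (dcRep φ U t * φ h)
    have hv : φ (v : H) ∈ U := v.2
    have hc : dcRep φ U t * φ (v : H) * (dcRep φ U t)⁻¹ ∈ U := hUn.conj_mem _ hv _
    have e : dcRep φ U t * φ ((v : H) * h) =
        (dcRep φ U t * φ (v : H) * (dcRep φ U t)⁻¹) * (dcRep φ U t * φ h) := by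
      rw [map_mul]; group
    rw [e]
    exact ((Representation.mem_coindV _ _ _).1 f.2) ⟨_, hc⟩ (dcRep φ U t * φ h)⟩

/-- Formula. [cite: Brown1982CohomologyGroups, III §5 Prop. 5.6 (b)] -/
@[simp]
theorem coindPullbackFun_apply (f : (coindPullbackSrc φ hφ U hU W (k := k)).obj.V) (h : H)
    (t : DoubleCosets φ U) : (coindPullbackFun φ hφ U hU W f).1 h t = f.1 (dcRep φ U t * φ h) := rfl

/-- **The Mackey map `Ψ : Res_φ Coind_U^Γ(W) ⟶ Coind_{φ⁻¹U}^H(W^T)` in `C_H`** (linear and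
`H`-equivariant: `Ψ (h₀ • f) h t = f (s(t) φ h φ h₀) = Ψ f (h h₀) t`).
[cite: Brown1982CohomologyGroups, III §5 Prop. 5.6 (b)] -/
def coindPullbackHom : coindPullbackSrc φ hφ U hU W (k := k) ⟶ coindPullbackTgt φ hφ U hU W :=
  ObjectProperty.homMk (Rep.ofHom
    { toFun := coindPullbackFun φ hφ U hU W
      map_add' := fun f g => Subtype.ext (funext fun h => funext fun t => rfl)
      map_smul' := fun c f => Subtype.ext (funext fun h => funext fun t => rfl)
      isIntertwining' := fun h₀ => LinearMap.ext fun f => Subtype.ext (funext fun h => funext fun t => by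
        change f.1 (dcRep φ U t * φ h * φ h₀) = f.1 (dcRep φ U t * φ (h * h₀))
        rw [map_mul, mul_assoc]) })

/-- Formula for `Ψ` on vectors. [cite: Brown1982CohomologyGroups, III §5 Prop. 5.6 (b)] -/
@[simp]
theorem coindPullbackHom_apply (f : (coindPullbackSrc φ hφ U hU W (k := k)).obj.V) (h : H)
    (t : DoubleCosets φ U) :
    ((coindPullbackHom φ hφ U hU W).hom.hom f).1 h t = f.1 (dcRep φ U t * φ h) := rfl

/-- `Ψ` is injective: every `x ∈ Γ` is `u · s(t) · φ h`, where `f x = f (s(t) φ h) = Ψ f h t`.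
[cite: Brown1982CohomologyGroups, III §5 Prop. 5.6 (b)] -/
theorem coindPullbackHom_injective :
    Function.Injective ((coindPullbackHom φ hφ U hU W (k := k)).hom.hom) := by
  intro f g hfg
  apply Subtype.ext
  funext x
  obtain ⟨u, h, hx⟩ := exists_decomp φ U x
  rw [hx, mul_assoc, coindPullbackSrc_apply_mul_left, coindPullbackSrc_apply_mul_left,
    ← coindPullbackHom_apply φ hφ U hU W f, ← coindPullbackHom_apply φ hφ U hU W g, hfg]

omit [IsTopologicalGroup Γ] [U.FiniteIndex] in
/-- Values of a `V`-invariant function agree on two decompositions over the same representative.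
[cite: Brown1982CohomologyGroups, III §5 Prop. 5.6 (b)] -/
theorem coindPullbackTgt_apply_eq_of_eq (F : (coindPullbackTgt φ hφ U hU W (k := k)).obj.V)
    {s : Γ} {u₁ u₂ : U} {h₁ h₂ : H} (e : (u₁ : Γ) * s * φ h₁ = (u₂ : Γ) * s * φ h₂) :
    F.1 h₁ = F.1 h₂ := by
  have hm := mul_inv_mem_comap_of_eq φ U e
  have := F.2 ⟨h₁ * h₂⁻¹, hm⟩ h₂
  change F.1 (h₁ * h₂⁻¹ * h₂) = F.1 h₂ at this
  rwa [inv_mul_cancel_right] at this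

/-- `Ψ` is surjective: `F ↦ (x ↦ F (h(x)) (t(x)))` for any decomposition `x = u · s(t(x)) · φ h(x)`
is a well-defined `U`-invariant preimage. [cite: Brown1982CohomologyGroups, III §5 Prop. 5.6 (b)] -/
theorem coindPullbackHom_surjective :
    Function.Surjective ((coindPullbackHom φ hφ U hU W (k := k)).hom.hom) := by
  intro F
  classical
  -- choose a decomposition of every `x`
  have hdec := exists_decomp φ U
  choose u h hx using hdec
  refine ⟨⟨fun x => F.1 (h x) (dcMk φ U x), fun u₀ x => ?_⟩, ?_⟩
  · -- `U`-invariance of the candidate preimage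
    change F.1 (h ((u₀ : Γ) * x)) (dcMk φ U ((u₀ : Γ) * x)) = F.1 (h x) (dcMk φ U x)
    have ht : dcMk φ U ((u₀ : Γ) * x) = dcMk φ U x := dcMk_mul_left φ U u₀ x
    rw [ht]
    have e1 := hx ((u₀ : Γ) * x)
    rw [ht] at e1
    have e2 : (u₀ : Γ) * x = ((u₀ * u x : U) : Γ) * dcRep φ U (dcMk φ U x) * φ (h x) := by
      rw [Subgroup.coe_mul, mul_assoc (u₀ : Γ), mul_assoc (u₀ : Γ), ← hx x]
    rw [coindPullbackTgt_apply_eq_of_eq φ hφ U hU W F (e1.symm.trans e2)]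
  · apply Subtype.ext
    funext h₀ t
    rw [coindPullbackHom_apply]
    change F.1 (h (dcRep φ U t * φ h₀)) (dcMk φ U (dcRep φ U t * φ h₀)) = F.1 h₀ t
    have ht : dcMk φ U (dcRep φ U t * φ h₀) = t := by rw [dcMk_mul_right, dcMk_dcRep]
    rw [ht]
    have e1 := hx (dcRep φ U t * φ h₀)
    rw [ht] at e1
    have e2 : dcRep φ U t * φ h₀ = ((1 : U) : Γ) * dcRep φ U t * φ h₀ := by
      rw [Subgroup.coe_one, one_mul]
    exact congrFun (coindPullbackTgt_apply_eq_of_eq φ hφ U hU W F (e1.symm.trans e2)) t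

/-- `Ψ` is bijective. [cite: Brown1982CohomologyGroups, III §5 Prop. 5.6 (b)] -/
theorem coindPullbackHom_bijective :
    Function.Bijective ((coindPullbackHom φ hφ U hU W (k := k)).hom.hom) :=
  ⟨coindPullbackHom_injective φ hφ U hU W, coindPullbackHom_surjective φ hφ U hU W⟩

/-- **Mackey's formula (normal case) as an isomorphism in `C_H`:
`Res_φ Coind_U^Γ (triv W) ≅ Coind_{φ⁻¹U}^H (triv (U\Γ/φ(H) → W))`.**
[cite: Brown1982CohomologyGroups, III §5 Prop. 5.6 (b)][cite: Harari2020, §17.5 Lemma 17.23 (proof)] -/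
def coindPullbackIso : coindPullbackSrc φ hφ U hU W (k := k) ≅ coindPullbackTgt φ hφ U hU W :=
  ObjectProperty.isoMk _ (Rep.mkIso
    (Representation.IntertwiningMap.ofBijective (coindPullbackHom φ hφ U hU W (k := k)).hom.hom
      (coindPullbackHom_bijective φ hφ U hU W)))

/-- The isomorphism IS `Ψ`. [cite: Brown1982CohomologyGroups, III §5 Prop. 5.6 (b)] -/
@[simp]
theorem coindPullbackIso_hom : (coindPullbackIso φ hφ U hU W (k := k)).hom = coindPullbackHom φ hφ U hU W :=
  rfl

/-- Formula for the isomorphism on vectors. [cite: Brown1982CohomologyGroups, III §5 Prop. 5.6 (b)] -/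
theorem coindPullbackIso_hom_apply (f : (coindPullbackSrc φ hφ U hU W (k := k)).obj.V) (h : H)
    (t : DoubleCosets φ U) :
    ((coindPullbackIso φ hφ U hU W).hom.hom.hom f).1 h t = f.1 (dcRep φ U t * φ h) := rfl

/-- Formula for the inverse: `Ψ⁻¹ F` takes the value `F h t` at `u · s(t) · φ h`.
[cite: Brown1982CohomologyGroups, III §5 Prop. 5.6 (b)] -/
theorem coindPullbackIso_inv_apply (F : (coindPullbackTgt φ hφ U hU W (k := k)).obj.V) (u : U)
    (t : DoubleCosets φ U) (h : H) :
    ((coindPullbackIso φ hφ U hU W).inv.hom.hom F).1 ((u : Γ) * dcRep φ U t * φ h) = F.1 h t := by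
  have hF : (coindPullbackIso φ hφ U hU W).hom.hom.hom ((coindPullbackIso φ hφ U hU W).inv.hom.hom F) =
      F := by
    change ((coindPullbackIso φ hφ U hU W).inv ≫ (coindPullbackIso φ hφ U hU W).hom).hom.hom F = F
    rw [Iso.inv_hom_id]
    rfl
  rw [mul_assoc, coindPullbackSrc_apply_mul_left, ← coindPullbackIso_hom_apply φ hφ U hU W _ h t, hF]

end Pullback

end DiscreteRep

end Literature.Algebra.Homology

end
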